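import Summits.ResolutionOfSingularities.ResolutionOfSingularities.Theorems.WildQuotientsSummitReductionStubPairOrbitNormalFormBlowupChartsOverCentreResidue
import HarnessLib

/-!
# `WildQuotients.SummitReduction` (stmt-ResolutionOfSingularities-16324), line `FramePerfect`, stub O3
# (`stub_pair_orbitNormalFormBlowup_chartsOverCentre`): the dimension of a chart at a closed
# point over the closed point, and the special points with all coordinates invertible

Route `ResolutionOfSingularities/WildQuotients`, crux `SummitReduction`; helper file of stub O3
(de Jong 1996, 4.27 [C2] on the coefficient-free model; residue polynomial ring in
`…ChartsOverCentreResidue.lean`). For the chart `R[𝔓/c_j]` of the blow-up of a regular local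
ring `R` along part `c` (length `n`) of a regular system of parameters `(c, w)` and a MAXIMAL
ideal `𝔔` over `𝔪_R` (a closed point of the blow-up over the closed point, rational or not),
this file PROVES:

* `chartsOverCentre_quot_localization` — `L/KL` is the localisation of `A/K` at `𝔔/K`
  (`K ≤ 𝔔`, `L = A_𝔔`);
* `chartsOverCentre_ringKrullDim_chart` — `dim R[𝔓/c_j]_𝔔 = (n - 1) + (l + 1) = dim R`: modulo
  the part `(c_j, w)` of a regular system of parameters the local ring is the localisation of
  `κ[T_k : k ≠ j]` at a maximal ideal, of dimension `n - 1` (affine domains are catenary);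
* `chartsOverCentre_isRsopPart_cons_elim` — if the strict transform at `𝔔` is
  `c_p/c_j - (c_q/c_j)(c_r/c_j) ∈ 𝔔` (`p ∉ {q, r}`; de Jong 1996, p. 76: the smooth quadric
  `u'v' = t₂'` of the chart "`t₁ ≠ 0`" with `s = 2`, resp. the graph `v' = t₁'t₂'` of the chart
  "`u ≠ 0`", at the points where all chart coordinates are invertible), then together with
  `(c_j, w)` it is part of a regular system of parameters: modulo `(c_j, w)` one gets the
  localisation of `κ[T]/(T_p - T_q T_r) ≅ κ[T']`, a regular ring of dimension `n - 2`.

## Sources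

* A. J. de Jong, *Smoothness, semi-stability and alterations*, Publ. Math. IHÉS 83 (1996), 4.27,
  p. 76. [DeJong1996]
* H. Matsumura, *Commutative Ring Theory* (1986), Thms. 5.6, 14.2, 19.3. [Matsumura1987]
-/

set_option linter.dupNamespace false -- the tree's summit namespace repeats `ResolutionOfSingularities`

noncomputable section

open IsLocalRing
open Literature.AlgebraicGeometry.Resolution

namespace Summit.ResolutionOfSingularities.ResolutionOfSingularities.Theorems

/-- **Localising a quotient**: for `K ≤ 𝔔`, `L/KL` is the localisation of `A/K` at `𝔔/K`; hence
`dim L/KL ≤ dim A/K` and, if `A/K` is a regular ring, `L/KL` is a regular local ring, and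
`dim L/KL = ht(𝔔/K)`. [cite: Matsumura1987, Thm. 19.3] -/
theorem chartsOverCentre_quot_localization {A L : Type} [CommRing A] [CommRing L] [Algebra A L]
    (𝔔 : Ideal A) [𝔔.IsPrime] [IsLocalization.AtPrime L 𝔔] (K : Ideal A) (hK : K ≤ 𝔔) :
    haveI : (𝔔.map (Ideal.Quotient.mk K)).IsPrime :=
      Ideal.map_isPrime_of_surjective Ideal.Quotient.mk_surjective (by rwa [Ideal.mk_ker])
    IsLocalization.AtPrime (L ⧸ K.map (algebraMap A L)) (𝔔.map (Ideal.Quotient.mk K)) := by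
  -- adapted from `isRegularLocalRing_quot_map_of_isRegularRing` (BlowupChartRsop.lean)
  haveI hp : (𝔔.map (Ideal.Quotient.mk K)).IsPrime :=
    Ideal.map_isPrime_of_surjective Ideal.Quotient.mk_surjective (by rwa [Ideal.mk_ker])
  have hcomap : (𝔔.map (Ideal.Quotient.mk K)).comap (Ideal.Quotient.mk K) = 𝔔 := by
    rw [Ideal.comap_map_of_surjective _ Ideal.Quotient.mk_surjective, ← RingHom.ker_eq_comap_bot,
      Ideal.mk_ker, sup_eq_left]
    exact hK
  have hmem : ∀ x : A, Ideal.Quotient.mk K x ∈ 𝔔.map (Ideal.Quotient.mk K) ↔ x ∈ 𝔔 := fun x => by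
    rw [← Ideal.mem_comap, hcomap]
  have hM : Algebra.algebraMapSubmonoid (A ⧸ K) 𝔔.primeCompl = (𝔔.map (Ideal.Quotient.mk K)).primeCompl := by
    ext b
    constructor
    · rintro ⟨x, hx, rfl⟩
      exact fun h => hx ((hmem x).mp h)
    · intro hb
      obtain ⟨x, rfl⟩ := Ideal.Quotient.mk_surjective b
      exact ⟨x, fun h => hb ((hmem x).mpr h), rfl⟩
  have := (inferInstance : IsLocalization (Algebra.algebraMapSubmonoid (A ⧸ K) 𝔔.primeCompl)
    (L ⧸ K.map (algebraMap A L)))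
  rwa [hM] at this

/-- **The dimension of the chart at a closed point over the closed point**: for `𝔔` a MAXIMAL
ideal of `R[𝔓/c_j]` over `𝔪_R` (`𝔓 = (c)` generated by part of a regular system of parameters
`(c, w)` of `R`, `c` of length `n ≥ 1`), `dim R[𝔓/c_j]_𝔔 = (n - 1) + (l + 1) = dim R`: the part
`(c_j, w)` of a regular system of parameters has quotient the localisation of `κ[T_k : k ≠ j]` at a
maximal ideal, of dimension `n - 1`. [cite: DeJong1996, 4.27, p. 76] [cite: Matsumura1987, Thm. 5.6 and 14.2] -/
theorem chartsOverCentre_ringKrullDim_chart {R : Type} [CommRing R] [IsRegularLocalRing R]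
    {n : ℕ} (c : Fin n → R) (j : Fin n) {l : ℕ} (w : Fin l → R)
    (hz : Ideal.span (Set.range (Fin.append c w)) = maximalIdeal R)
    (hd : (maximalIdeal R).spanFinrank = n + l)
    (𝔓 : Ideal R) (h𝔓 : 𝔓 = Ideal.span (Set.range c)) (hc : ∀ k, c k ∈ 𝔓)
    (𝔔 : Ideal (blowupAlgebra 𝔓 (c j))) [𝔔.IsMaximal]
    (h𝔔 : 𝔔.comap (algebraMap R _) = maximalIdeal R)
    (L : Type) [CommRing L] [IsLocalRing L] [Algebra (blowupAlgebra 𝔓 (c j)) L]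
    [IsLocalization.AtPrime L 𝔔] :
    ringKrullDim L = ((n - 1) + (l + 1) : ℕ) := by
  classical
  obtain ⟨θ, hθs, hθk, hθC, hθX⟩ := chartsOverCentre_exists_residuePolynomialMap c j w hz hd 𝔓 h𝔓 hc
  -- the part `(c_j, w)` and its ideal `K₀ L`, `K₀ = ker θ`
  have hrs := chartsOverCentre_isRsopPart_chartFamily c j w hz hd 𝔓 h𝔓 hc 𝔔 h𝔔 L
    (a := 0) Fin.elim0 (Function.injective_of_subsingleton _) (fun t => Fin.elim0 t)
  have hspan : Ideal.span (Set.range (chartFamily c j w L (algebraMap R (blowupAlgebra 𝔓 (c j)))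
      (fun k => blowupAlgebra.gen 𝔓 (c j) (c k) (hc k)) Fin.elim0)) =
      (RingHom.ker θ).map (algebraMap (blowupAlgebra 𝔓 (c j)) L) := by
    rw [span_range_chartFamily, hθk, List.ofFn_zero, List.nil_append, Ideal.ofList_cons,
      Ideal.ofList_ofFn, Ideal.map_span (algebraMap R _), ← Set.range_comp]
    rfl
  have hK𝔔 : RingHom.ker θ ≤ 𝔔 := by
    rw [hθk]
    refine sup_le ?_ ?_
    · rw [Ideal.span_singleton_le_iff_mem]
      exact map_centre_mem c w hz (algebraMap R _) 𝔔 h𝔔 j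
    · rw [Ideal.map_le_iff_le_comap]
      refine Ideal.span_le.mpr ?_
      rintro _ ⟨k, rfl⟩
      exact map_w_mem c w hz (algebraMap R _) 𝔔 h𝔔 k
  -- `dim L = dim L/(c_j, w) + (l + 1)`
  have h1 := hrs.ringKrullDim_quotient_add
  rw [hspan] at h1
  -- `L/K₀L` is the localisation of `A/K₀ ≅ κ[T]` at a maximal ideal: dimension `n - 1`
  haveI hp : (𝔔.map (Ideal.Quotient.mk (RingHom.ker θ))).IsPrime :=
    Ideal.map_isPrime_of_surjective Ideal.Quotient.mk_surjective (by rwa [Ideal.mk_ker])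
  haveI := chartsOverCentre_quot_localization 𝔔 (RingHom.ker θ) hK𝔔 (L := L)
  have h2 : ringKrullDim (L ⧸ (RingHom.ker θ).map (algebraMap (blowupAlgebra 𝔓 (c j)) L)) =
      (𝔔.map (Ideal.Quotient.mk (RingHom.ker θ))).height :=
    IsLocalization.AtPrime.ringKrullDim_eq_height _ _
  -- transport the height along `A/K₀ ≅ κ[T]`
  let Γ := RingHom.quotientKerEquivOfSurjective hθs
  haveI h𝔔max : (𝔔.map θ).IsMaximal := Ideal.IsMaximal.map_of_surjective_of_ker_le hθs hK𝔔
  have hmemθ : ∀ a, θ a ∈ 𝔔.map θ ↔ a ∈ 𝔔 := by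
    intro a
    constructor
    · intro ha
      obtain ⟨a', ha', h⟩ := (Ideal.mem_map_iff_of_surjective θ hθs).mp ha
      have : a - a' ∈ RingHom.ker θ := by rw [RingHom.mem_ker, map_sub, h, sub_self]
      simpa using 𝔔.add_mem (hK𝔔 this) ha'
    · exact fun ha => Ideal.mem_map_of_mem θ ha
  have hmemK : ∀ a, Ideal.Quotient.mk (RingHom.ker θ) a ∈ 𝔔.map (Ideal.Quotient.mk (RingHom.ker θ)) ↔
      a ∈ 𝔔 := by
    intro a
    rw [← Ideal.mem_comap, Ideal.comap_map_of_surjective _ Ideal.Quotient.mk_surjective,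
      ← RingHom.ker_eq_comap_bot, Ideal.mk_ker, sup_eq_left.mpr hK𝔔]
  have h3 : (𝔔.map θ).comap Γ = 𝔔.map (Ideal.Quotient.mk (RingHom.ker θ)) := by
    ext x
    obtain ⟨a, rfl⟩ := Ideal.Quotient.mk_surjective x
    rw [Ideal.mem_comap, hmemK, show Γ (Ideal.Quotient.mk (RingHom.ker θ) a) = θ a from
      RingHom.quotientKerEquivOfSurjective_apply_mk hθs a, hmemθ]
  have h4 : (𝔔.map (Ideal.Quotient.mk (RingHom.ker θ))).height = (𝔔.map θ).height := by
    rw [← h3, RingEquiv.height_comap]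
  have h5 : ringKrullDim (Localization.AtPrime (𝔔.map θ)) = ((n - 1 : ℕ) : WithBot ℕ∞) := by
    rw [chartsOverCentre_ringKrullDim_localization_mvPolynomial (K := ResidueField R)
        (σ := {k : Fin n // k ≠ j}) (𝔔.map θ) (Localization.AtPrime (𝔔.map θ)),
      Fintype.card_subtype_compl, Fintype.card_subtype_eq, Fintype.card_fin]
  rw [IsLocalization.AtPrime.ringKrullDim_eq_height (𝔔.map θ) (Localization.AtPrime (𝔔.map θ))] at h5
  rw [h2, h4] at h1
  rw [← h1]
  have h5' : ((𝔔.map θ).height : WithBot ℕ∞) = ((n - 1 : ℕ) : WithBot ℕ∞) := h5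
  rw [h5', zero_add]
  push_cast
  ring

/-- **The special points with all coordinates invertible**: if the strict transform at a maximal
`𝔔` over `𝔪_R` is `f = c_p/c_j - (c_q/c_j)(c_r/c_j)` (three distinct indices `p, q, r ≠ j`; the
smooth quadric `u'v' = t₂'` of the chart "`t₁ ≠ 0`" with `s = 2`, or the graph `v' = t₁'t₂'` of the
chart "`u ≠ 0`", de Jong 1996, p. 76) and `f ∈ 𝔔`, then `(f, c_j, w)` is part of a regular system
of parameters of `R[𝔓/c_j]_𝔔`: modulo `(c_j, w)` the quotient is the localisation of
`κ[T]/(T_p - T_q T_r) ≅ κ[T']`, a regular ring of dimension `n - 2`, while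
`dim R[𝔓/c_j]_𝔔 = (n - 1) + (l + 1)`. [cite: DeJong1996, 4.27, p. 76] [cite: Matsumura1987, Thm. 14.2] -/
theorem chartsOverCentre_isRsopPart_cons_elim {R : Type} [CommRing R] [IsRegularLocalRing R]
    {n : ℕ} (c : Fin n → R) (j : Fin n) {l : ℕ} (w : Fin l → R)
    (hz : Ideal.span (Set.range (Fin.append c w)) = maximalIdeal R)
    (hd : (maximalIdeal R).spanFinrank = n + l)
    (𝔓 : Ideal R) (h𝔓 : 𝔓 = Ideal.span (Set.range c)) (hc : ∀ k, c k ∈ 𝔓)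
    (𝔔 : Ideal (blowupAlgebra 𝔓 (c j))) [𝔔.IsMaximal]
    (h𝔔 : 𝔔.comap (algebraMap R _) = maximalIdeal R)
    (L : Type) [CommRing L] [IsLocalRing L] [Algebra (blowupAlgebra 𝔓 (c j)) L]
    [IsLocalization.AtPrime L 𝔔]
    (p q r : {k : Fin n // k ≠ j}) (hqp : q ≠ p) (hrp : r ≠ p)
    (hf : blowupAlgebra.gen 𝔓 (c j) (c p) (hc p) -
      blowupAlgebra.gen 𝔓 (c j) (c q) (hc q) * blowupAlgebra.gen 𝔓 (c j) (c r) (hc r) ∈ 𝔔) :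
    IsRsopPart (Fin.cons (algebraMap (blowupAlgebra 𝔓 (c j)) L
        (blowupAlgebra.gen 𝔓 (c j) (c p) (hc p) -
          blowupAlgebra.gen 𝔓 (c j) (c q) (hc q) * blowupAlgebra.gen 𝔓 (c j) (c r) (hc r)))
      (chartFamily c j w L (algebraMap R (blowupAlgebra 𝔓 (c j)))
        (fun k => blowupAlgebra.gen 𝔓 (c j) (c k) (hc k)) Fin.elim0) : Fin (0 + l + 1 + 1) → L) := by
  classical
  obtain ⟨θ, hθs, hθk, hθC, hθX⟩ := chartsOverCentre_exists_residuePolynomialMap c j w hz hd 𝔓 h𝔓 hc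
  haveI : IsNoetherianRing L := IsLocalization.isNoetherianRing 𝔔.primeCompl L (by
    obtain ⟨Λ, -, -⟩ := chartsOverCentre_exists_reesChart_equiv c j 𝔓 h𝔓 hc
    haveI : IsNoetherianRing (chartRing c j) := isNoetherianRing_blowupChart c j
    exact isNoetherianRing_of_ringEquiv (chartRing c j) Λ)
  set fA := blowupAlgebra.gen 𝔓 (c j) (c p) (hc p) -
    blowupAlgebra.gen 𝔓 (c j) (c q) (hc q) * blowupAlgebra.gen 𝔓 (c j) (c r) (hc r) with hfA
  set g : MvPolynomial {k : Fin n // k ≠ j} (ResidueField R) :=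
    MvPolynomial.X p - MvPolynomial.X q * MvPolynomial.X r with hg
  have hθf : θ fA = g := by rw [hfA, map_sub, map_mul, hθX, hθX, hθX]
  -- the part `(c_j, w)`, `K₀ = ker θ`, `dim L`
  have hrs := chartsOverCentre_isRsopPart_chartFamily c j w hz hd 𝔓 h𝔓 hc 𝔔 h𝔔 L
    (a := 0) Fin.elim0 (Function.injective_of_subsingleton _) (fun t => Fin.elim0 t)
  have hspan : Ideal.span (Set.range (chartFamily c j w L (algebraMap R (blowupAlgebra 𝔓 (c j)))
      (fun k => blowupAlgebra.gen 𝔓 (c j) (c k) (hc k)) Fin.elim0)) =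
      (RingHom.ker θ).map (algebraMap (blowupAlgebra 𝔓 (c j)) L) := by
    rw [span_range_chartFamily, hθk, List.ofFn_zero, List.nil_append, Ideal.ofList_cons,
      Ideal.ofList_ofFn, Ideal.map_span (algebraMap R _), ← Set.range_comp]
    rfl
  have hK𝔔 : RingHom.ker θ ≤ 𝔔 := by
    rw [hθk]
    refine sup_le ?_ ?_
    · rw [Ideal.span_singleton_le_iff_mem]
      exact map_centre_mem c w hz (algebraMap R _) 𝔔 h𝔔 j
    · rw [Ideal.map_le_iff_le_comap]
      refine Ideal.span_le.mpr ?_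
      rintro _ ⟨k, rfl⟩
      exact map_w_mem c w hz (algebraMap R _) 𝔔 h𝔔 k
  have hdimL := chartsOverCentre_ringKrullDim_chart c j w hz hd 𝔓 h𝔓 hc 𝔔 h𝔔 L
  -- the surjection `θ' : A → κ[T]/(g)` with kernel `K' = ker θ + (f)`
  let θ' := (Ideal.Quotient.mk (Ideal.span {g})).comp θ
  have hθ's : Function.Surjective θ' := Ideal.Quotient.mk_surjective.comp hθs
  have hkerθ' : RingHom.ker θ' = RingHom.ker θ ⊔ Ideal.span {fA} := by
    change RingHom.ker ((Ideal.Quotient.mk (Ideal.span {g})).comp θ) = _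
    rw [← RingHom.comap_ker, Ideal.mk_ker, ← hθf, ← Set.image_singleton, ← Ideal.map_span,
      Ideal.comap_map_of_surjective _ hθs, ← RingHom.ker_eq_comap_bot, sup_comm]
  have hK'𝔔 : RingHom.ker θ' ≤ 𝔔 := by
    rw [hkerθ']
    exact sup_le hK𝔔 ((Ideal.span_singleton_le_iff_mem _).mpr hf)
  obtain ⟨hregq, hdimq⟩ := chartsOverCentre_isRegularRing_elim (K := ResidueField R) p q r hqp hrp
  haveI : IsRegularRing (blowupAlgebra 𝔓 (c j) ⧸ RingHom.ker θ') :=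
    IsRegularRing.of_ringEquiv (RingHom.quotientKerEquivOfSurjective hθ's).symm
  haveI hregL := isRegularLocalRing_quot_map_of_isRegularRing L 𝔔 (RingHom.ker θ') hK'𝔔
  -- the ideal of the family is `K' L`
  have hspan' : Ideal.span (Set.range (Fin.cons (algebraMap (blowupAlgebra 𝔓 (c j)) L fA)
      (chartFamily c j w L (algebraMap R (blowupAlgebra 𝔓 (c j)))
        (fun k => blowupAlgebra.gen 𝔓 (c j) (c k) (hc k)) Fin.elim0) : Fin (0 + l + 1 + 1) → L)) =
      (RingHom.ker θ').map (algebraMap (blowupAlgebra 𝔓 (c j)) L) := by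
    rw [Fin.range_cons, Ideal.span_insert, hspan, hkerθ', Ideal.map_sup, Ideal.map_span,
      Set.image_singleton, sup_comm]
  -- the criterion
  haveI : IsRegularLocalRing (L ⧸ Ideal.span (Set.range (Fin.cons (algebraMap (blowupAlgebra 𝔓 (c j)) L fA)
      (chartFamily c j w L (algebraMap R (blowupAlgebra 𝔓 (c j)))
        (fun k => blowupAlgebra.gen 𝔓 (c j) (c k) (hc k)) Fin.elim0) : Fin (0 + l + 1 + 1) → L))) := by
    rw [hspan']
    exact hregL
  refine IsRsopPart.of_isRegularLocalRing_quotient (fun i => ?_) ?_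
  · refine Fin.cases ?_ (fun i => ?_) i
    · rw [Fin.cons_zero]
      exact (IsLocalization.AtPrime.to_map_mem_maximal_iff L 𝔔 _).mpr hf
    · rw [Fin.cons_succ]
      exact hrs.mem_maximalIdeal i
  · rw [hspan']
    haveI hp' : (𝔔.map (Ideal.Quotient.mk (RingHom.ker θ'))).IsPrime :=
      Ideal.map_isPrime_of_surjective Ideal.Quotient.mk_surjective (by rwa [Ideal.mk_ker])
    haveI := chartsOverCentre_quot_localization 𝔔 (RingHom.ker θ') hK'𝔔 (L := L)
    have h1 : ringKrullDim (L ⧸ (RingHom.ker θ').map (algebraMap (blowupAlgebra 𝔓 (c j)) L)) ≤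
        ringKrullDim (blowupAlgebra 𝔓 (c j) ⧸ RingHom.ker θ') := by
      rw [IsLocalization.AtPrime.ringKrullDim_eq_height (𝔔.map (Ideal.Quotient.mk (RingHom.ker θ')))
        (L ⧸ (RingHom.ker θ').map (algebraMap (blowupAlgebra 𝔓 (c j)) L))]
      exact Ideal.height_le_ringKrullDim_of_ne_top hp'.ne_top
    have h2 : ringKrullDim (blowupAlgebra 𝔓 (c j) ⧸ RingHom.ker θ') = ((n - 1 - 1 : ℕ) : WithBot ℕ∞) := by
      rw [ringKrullDim_eq_of_ringEquiv (RingHom.quotientKerEquivOfSurjective hθ's), hdimq,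
        Fintype.card_subtype_compl, Fintype.card_subtype_eq, Fintype.card_fin]
    rw [hdimL]
    have hn : 3 ≤ n := by
      have hpq : p.1 ≠ q.1 := fun h => hqp (Subtype.ext h).symm
      have h3 : ({j, p.1, q.1} : Finset (Fin n)).card = 3 := by
        rw [Finset.card_insert_of_notMem, Finset.card_pair hpq]
        simp only [Finset.mem_insert, Finset.mem_singleton, not_or]
        exact ⟨p.2.symm, q.2.symm⟩
      have := Finset.card_le_univ ({j, p.1, q.1} : Finset (Fin n))
      rw [h3, Fintype.card_fin] at this
      exact this
    calc ringKrullDim (L ⧸ (RingHom.ker θ').map (algebraMap (blowupAlgebra 𝔓 (c j)) L)) +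
          ((0 + l + 1 + 1 : ℕ) : WithBot ℕ∞)
        ≤ ((n - 1 - 1 : ℕ) : WithBot ℕ∞) + ((0 + l + 1 + 1 : ℕ) : WithBot ℕ∞) := by
          exact add_le_add (h1.trans h2.le) le_rfl
      _ = (((n - 1) + (l + 1) : ℕ) : WithBot ℕ∞) := by
          norm_cast
          omega


end Summit.ResolutionOfSingularities.ResolutionOfSingularities.Theorems

end
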